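import Mathlib
import Summits.Langlands.Langlands.Theses.QuadraticWindow
import Literature.NumberTheory.Automorphic.AutomorphicTwistBJ
import Literature.NumberTheory.Automorphic.SelfdualGL3AdjointLiftProofs
import Literature.NumberTheory.Automorphic.ReciprocityGLn
import Literature.NumberTheory.GaloisRepresentations.HeckeCharacterGaloisAvatarProofs
import Literature.NumberTheory.GaloisRepresentations.TwistedSumAssembly
import Literature.NumberTheory.GaloisRepresentations.TwistedSumFiniteOrderGeneric
import Literature.RepresentationTheory.Semisimple.Twist
import Literature.NumberTheory.GaloisRepresentations.HeckeLFunctionAnalyticProofs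

/-!
# Support for `TwistNormalization` (route `QuadraticWindow`, stmt-Langlands-10904), VI:
# non-`τ`-invariance of one of two twists, and untwisting on the Galois side

* `twist_not_invariant_or` — if `π` (automorphic on `GL_n/F`, `F/F₀` quadratic with automorphism
  `τ`) is not `τ`-invariant on Satake parameters, `λ`, `ϑ` are finite-order Hecke characters, the
  values `ϑ(ϖ_w)` are `p`-th roots of unity (`p > n` prime) almost everywhere and
  `ϑ(ϖ_w) ≠ ϑ(ϖ_{τw})` for infinitely many `w`, then `π ⊗ λ` or `π ⊗ λϑ` is not `τ`-invariant:
  otherwise `t_{π,w}` is stable under multiplication by the non-trivial `p`-th root of unity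
  `ϑ(ϖ_w)/ϑ(ϖ_{τw})` at such a `w`, forcing `t_{π,w} ⊆ {0}`, while Satake parameters are non-zero
  (`HasSatakeParamAt.zero_not_mem`) and `n ≥ 1`.
* `untwist_galoisRep` — from a semisimple `ρ' : Γ_F → GL_n(ℚ̄_ℓ)` matching the Satake parameters
  of `π ⊗ μ` almost everywhere, the twist `ρ' ⊗ r_{μ⁻¹}` by the `ℓ`-adic avatar of `μ⁻¹`
  (`HeckeCharacter.exists_lAdic_of_isFiniteOrder`, Serre 1968 Ch. III §2.3) matches those of `π`
  (`t_{π⊗μ,w} = μ(ϖ_w) t_{π,w}` and the roots of the Frobenius polynomial scale by `ι⁻¹(μ(ϖ_w))⁻¹`).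

References: Arthur–Clozel 1989, Ch. 3, proof of Thm. 3.1 (p. 172); Serre, *Abelian ℓ-adic
representations* (1968), Ch. I §2, Ch. III §2.3.
-/

set_option linter.dupNamespace false -- project-wide option (lakefile weak.linter.dupNamespace); `Summit.Langlands.Langlands` is the mandated namespace

noncomputable section

open Literature.NumberTheory.GaloisRepresentations Literature.NumberTheory.Automorphic
open Field IsDedekindDomain NumberField Polynomial Filter
open scoped MatrixGroups Classical

namespace Summit.Langlands.Langlands.Theorems.TwistNormalization

/-! ## Small lemmas -/

/-- A multiset of fewer than `p` non-zero complex numbers stable under multiplication by a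
non-trivial `p`-th root of unity (`p` prime) is empty. [folklore] -/
theorem Multiset.eq_zero_of_map_mul_eq {α : Multiset ℂ} {ζ : ℂ} {p : ℕ} (hp : p.Prime) (hζp : ζ ^ p = 1)
    (hζ : ζ ≠ 1) (hcard : Multiset.card α < p) (h0 : (0 : ℂ) ∉ α) (h : α.map (ζ * ·) = α) : α = 0 := by
  by_contra hne
  obtain ⟨a, ha⟩ := Multiset.exists_mem_of_ne_zero hne
  have ha0 : a ≠ 0 := fun h' => h0 (h' ▸ ha)
  have hmem : ∀ i : ℕ, ζ ^ i * a ∈ α := by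
    intro i
    induction i with
    | zero => simpa using ha
    | succ i ih =>
      have : ζ * (ζ ^ i * a) ∈ α.map (ζ * ·) := Multiset.mem_map_of_mem _ ih
      rw [h] at this
      rw [pow_succ, mul_comm (ζ ^ i) ζ, mul_assoc]
      exact this
  haveI := Fact.mk hp
  have hord : orderOf ζ = p := orderOf_eq_prime hζp hζ
  have hfin : IsOfFinOrder ζ := isOfFinOrder_iff_pow_eq_one.mpr ⟨p, hp.pos, hζp⟩
  have hinj : Set.InjOn (fun i : ℕ => ζ ^ i * a) (Finset.range p) := by
    intro i hi j hj hij
    simp only [Finset.coe_range, Set.mem_Iio] at hi hj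
    have h1 : ζ ^ i = ζ ^ j := mul_right_cancel₀ ha0 hij
    rw [hfin.pow_eq_pow_iff_modEq, hord] at h1
    exact Nat.ModEq.eq_of_lt_of_lt h1 hi hj
  have hsub : (Finset.range p).image (fun i : ℕ => ζ ^ i * a) ⊆ α.toFinset := by
    intro x hx
    obtain ⟨i, -, rfl⟩ := Finset.mem_image.mp hx
    exact Multiset.mem_toFinset.mpr (hmem i)
  have := Finset.card_le_card hsub
  rw [Finset.card_image_of_injOn hinj, Finset.card_range] at this
  exact absurd (this.trans (Multiset.toFinset_card_le α)) (not_le.mpr hcard)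

section Hecke

variable {K : Type} [Field K] [NumberField K]

/-- `χψ` is unramified where `χ` and `ψ` are. [folklore] -/
theorem isUnramifiedAt_mul {χ ψ : HeckeCharacter K} {v : HeightOneSpectrum (𝓞 K)} (hχ : χ.IsUnramifiedAt v)
    (hψ : ψ.IsUnramifiedAt v) : (χ * ψ).IsUnramifiedAt v := fun u => by
  rw [HeckeCharacter.localComponent_apply, HeckeCharacter.mul_apply]
  have h1 := hχ u
  have h2 := hψ u
  rw [HeckeCharacter.localComponent_apply] at h1 h2
  rw [h1, h2, mul_one]

/-- A Hecke character is unramified almost everywhere. [folklore] -/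
theorem eventually_isUnramifiedAt (χ : HeckeCharacter K) :
    ∀ᶠ v : HeightOneSpectrum (𝓞 K) in cofinite, χ.IsUnramifiedAt v :=
  (HeckeCharacter.finite_ramifiedPlaces_iff χ).mp χ.finite_ramifiedPlaces_holds

end Hecke

/-- **Scaling a matrix scales the roots of its characteristic polynomial** (product form): if
`charpoly M = ∏_{a ∈ s} (X - a)` then `charpoly (c • M) = ∏_{a ∈ s} (X - c a)` (`c ≠ 0`). [folklore] -/
theorem Matrix.charpoly_smul_eq_prod {m : Type*} [Fintype m] [DecidableEq m] {L : Type*} [Field L]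
    (M : Matrix m m L) {c : L} (hc : c ≠ 0) {s : Multiset L}
    (hM : M.charpoly = (s.map fun a => X - C a).prod) :
    (c • M).charpoly = (s.map fun a => X - C (c * a)).prod := by
  have hroots : M.charpoly.roots = s := by rw [hM, Polynomial.roots_multiset_prod_X_sub_C]
  have hcards : Multiset.card s = Fintype.card m := by
    have h := congrArg Polynomial.natDegree hM
    rwa [Matrix.charpoly_natDegree_eq_dim, Polynomial.natDegree_multiset_prod_X_sub_C_eq_card, eq_comm] at h
  have hcard : (c • M).charpoly.roots.card = (c • M).charpoly.natDegree := by
    rw [TwistedSum.roots_charpoly_smul M hc, Multiset.card_map, hroots, Matrix.charpoly_natDegree_eq_dim, hcards]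
  rw [← prod_multiset_X_sub_C_of_monic_of_roots_card_eq (Matrix.charpoly_monic _) hcard,
    TwistedSum.roots_charpoly_smul M hc, hroots, Multiset.map_map]
  rfl

section RankOne

variable {K : Type} [Field K] [NumberField K] {A : Type*} [CommRing A] [TopologicalSpace A]
  [IsTopologicalRing A]

/-- A Frobenius clause `X - C a` of a rank-one `ρ` over any coefficient ring, read through `det ρ`.
[folklore] -/
theorem hasFrobCharpolyAt_iff_det' (ρ : FramedGaloisRep K A 1) (v : HeightOneSpectrum (𝓞 K)) (a : A) :
    ρ.HasFrobCharpolyAt v (X - C a) ↔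
      ∀ 𝔓 ∈ v.primesAbove, ∀ Φ : absoluteGaloisGroup K, IsArithFrobAt (𝓞 K) Φ 𝔓 →
        ((FramedRep.det ρ Φ : Aˣ) : A) = a := by
  rw [FramedGaloisRep.hasFrobCharpolyAt_iff_of_rank_one]
  refine forall₂_congr fun 𝔓 _ => forall₂_congr fun Φ _ => ?_
  rw [FramedRep.det_apply, Matrix.GeneralLinearGroup.val_det_apply, Matrix.det_fin_one]

end RankOne

/-! ## One of two twists is not `τ`-invariant -/

section Dichotomy

variable {F₀ F : Type} [Field F₀] [Field F] [NumberField F] [Algebra F₀ F]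

/-- **`π ⊗ λ` or `π ⊗ λϑ` is not `τ`-invariant** (on Satake parameters), for `π` not
`τ`-invariant, `ϑ(ϖ_w)` a `p`-th root of unity a.e. (`p > n` prime) and `ϑ(ϖ_w) ≠ ϑ(ϖ_{τ w})`
for infinitely many `w` (the self-twist argument read on Satake parameters: stability of `t_{π,w}`
under a non-trivial `p`-th root of unity with `p > n` is impossible for non-zero parameters).
Arthur–Clozel 1989, Ch. 3, proof of Thm. 3.1 and §6. [folklore] -/
theorem twist_not_invariant_or [NumberField F₀] (τ : F ≃ₐ[F₀] F) {n : ℕ} {hcpt : isCompact_glFiniteIntegralLevel n F}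
    (π : AutomorphicRepData (AutomorphyDatum.gl n F hcpt))
    (hnti : ∃ᶠ w in Filter.cofinite, ∃ α β : Multiset ℂ, π.HasSatakeParamAt w α ∧
      π.HasSatakeParamAt (τ • w) β ∧ β ≠ α)
    (lam ϑ : HeckeCharacter F) (hlam : lam.IsFiniteOrder) (hlamϑ : (lam * ϑ).IsFiniteOrder)
    {p : ℕ} (hp : p.Prime) (hnp : n < p)
    (hϑp : ∀ᶠ w : HeightOneSpectrum (𝓞 F) in cofinite, ϑ.valueAtUniformizer w ^ p = 1)
    (hsep : {w : HeightOneSpectrum (𝓞 F) | ϑ.valueAtUniformizer w ≠ ϑ.valueAtUniformizer (τ • w)}.Infinite) :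
    (∃ᶠ w in Filter.cofinite, ∃ α β : Multiset ℂ, (π.twist lam hlam).HasSatakeParamAt w α ∧
      (π.twist lam hlam).HasSatakeParamAt (τ • w) β ∧ β ≠ α) ∨
    (∃ᶠ w in Filter.cofinite, ∃ α β : Multiset ℂ, (π.twist (lam * ϑ) hlamϑ).HasSatakeParamAt w α ∧
      (π.twist (lam * ϑ) hlamϑ).HasSatakeParamAt (τ • w) β ∧ β ≠ α) := by
  by_contra hcon
  rw [not_or, Filter.not_frequently, Filter.not_frequently] at hcon
  obtain ⟨H0, H1⟩ := hcon
  -- `n ≥ 1` from `hnti`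
  obtain ⟨w₁, α₁, β₁, hα₁, hβ₁, hne₁⟩ := hnti.exists
  have hn : n ≠ 0 := by
    intro hn
    apply hne₁
    rw [Multiset.card_eq_zero.mp (hβ₁.card_eq.trans hn), Multiset.card_eq_zero.mp (hα₁.card_eq.trans hn)]
  -- the cofinite good set
  have hτinj : Function.Injective fun w : HeightOneSpectrum (𝓞 F) => τ • w := MulAction.injective τ
  have g1 : ∀ᶠ w : HeightOneSpectrum (𝓞 F) in cofinite, π.IsUnramifiedAt w := π.hasSatakeParamAt_cofinite_holds
  have g2 : ∀ᶠ w : HeightOneSpectrum (𝓞 F) in cofinite, π.IsUnramifiedAt (τ • w) :=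
    hτinj.tendsto_cofinite.eventually g1
  have g3 := π.eventually_hasSatakeParamAt_twist hlam
  have g4 : ∀ᶠ w : HeightOneSpectrum (𝓞 F) in cofinite, ∀ α, π.HasSatakeParamAt (τ • w) α →
      (π.twist lam hlam).HasSatakeParamAt (τ • w) (α.map (lam.valueAtUniformizer (τ • w) * ·)) :=
    hτinj.tendsto_cofinite.eventually g3
  have g5 := π.eventually_hasSatakeParamAt_twist hlamϑ
  have g6 : ∀ᶠ w : HeightOneSpectrum (𝓞 F) in cofinite, ∀ α, π.HasSatakeParamAt (τ • w) α →
      (π.twist (lam * ϑ) hlamϑ).HasSatakeParamAt (τ • w) (α.map ((lam * ϑ).valueAtUniformizer (τ • w) * ·)) :=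
    hτinj.tendsto_cofinite.eventually g5
  have g7 : ∀ᶠ w : HeightOneSpectrum (𝓞 F) in cofinite, ϑ.valueAtUniformizer (τ • w) ^ p = 1 :=
    hτinj.tendsto_cofinite.eventually hϑp
  have hgood : ∀ᶠ w : HeightOneSpectrum (𝓞 F) in cofinite, π.IsUnramifiedAt w ∧ π.IsUnramifiedAt (τ • w) ∧
      (∀ α, π.HasSatakeParamAt w α → (π.twist lam hlam).HasSatakeParamAt w (α.map (lam.valueAtUniformizer w * ·))) ∧
      (∀ α, π.HasSatakeParamAt (τ • w) α →
        (π.twist lam hlam).HasSatakeParamAt (τ • w) (α.map (lam.valueAtUniformizer (τ • w) * ·))) ∧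
      (∀ α, π.HasSatakeParamAt w α →
        (π.twist (lam * ϑ) hlamϑ).HasSatakeParamAt w (α.map ((lam * ϑ).valueAtUniformizer w * ·))) ∧
      (∀ α, π.HasSatakeParamAt (τ • w) α →
        (π.twist (lam * ϑ) hlamϑ).HasSatakeParamAt (τ • w) (α.map ((lam * ϑ).valueAtUniformizer (τ • w) * ·))) ∧
      ϑ.valueAtUniformizer w ^ p = 1 ∧ ϑ.valueAtUniformizer (τ • w) ^ p = 1 ∧
      (∀ α β : Multiset ℂ, (π.twist lam hlam).HasSatakeParamAt w α →
        (π.twist lam hlam).HasSatakeParamAt (τ • w) β → β = α) ∧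
      (∀ α β : Multiset ℂ, (π.twist (lam * ϑ) hlamϑ).HasSatakeParamAt w α →
        (π.twist (lam * ϑ) hlamϑ).HasSatakeParamAt (τ • w) β → β = α) := by
    filter_upwards [g1, g2, g3, g4, g5, g6, hϑp, g7, H0, H1] with w h1 h2 h3 h4 h5 h6 h7 h8 h9 h10
    refine ⟨h1, h2, h3, h4, h5, h6, h7, h8, fun α β hα hβ => ?_, fun α β hα hβ => ?_⟩
    · by_contra hne; exact h9 ⟨α, β, hα, hβ, hne⟩
    · by_contra hne; exact h10 ⟨α, β, hα, hβ, hne⟩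
  -- a separating place in the good set
  rw [Filter.eventually_cofinite] at hgood
  obtain ⟨w, hwsep, hwgood⟩ := (hsep.sdiff hgood).nonempty
  simp only [Set.mem_setOf_eq, not_not] at hwgood hwsep
  obtain ⟨⟨α, hα⟩, ⟨β, hβ⟩, t3, t4, t5, t6, hup, hu'p, inv0, inv1⟩ := hwgood
  set l := lam.valueAtUniformizer w
  set l' := lam.valueAtUniformizer (τ • w)
  set u := ϑ.valueAtUniformizer w
  set u' := ϑ.valueAtUniformizer (τ • w)
  have hl : l ≠ 0 := Units.ne_zero _
  have hl' : l' ≠ 0 := Units.ne_zero _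
  have hu : u ≠ 0 := Units.ne_zero _
  have hu' : u' ≠ 0 := Units.ne_zero _
  have e0 : β.map (l' * ·) = α.map (l * ·) := inv0 _ _ (t3 α hα) (t4 β hβ)
  have e1 : β.map (l' * u' * ·) = α.map (l * u * ·) := by
    have := inv1 _ _ (t5 α hα) (t6 β hβ)
    rwa [HeckeCharacter.valueAtUniformizer_mul, HeckeCharacter.valueAtUniformizer_mul] at this
  -- `α` is stable under `ζ = u / u'`
  have hdag : α.map (fun a => l * u * a) = α.map (fun a => u' * (l * a)) := by
    have h := congrArg (Multiset.map (u' * ·)) e0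
    rw [Multiset.map_map, Multiset.map_map] at h
    simp only [Function.comp_def] at h
    rw [← e1, ← h]
    exact Multiset.map_congr rfl (fun b _ => by ring)
  set ζ := u * u'⁻¹ with hζ
  have hstab : α.map (ζ * ·) = α := by
    have h := congrArg (Multiset.map ((l * u')⁻¹ * ·)) hdag
    rw [Multiset.map_map, Multiset.map_map] at h
    have lhs : α.map (((l * u')⁻¹ * ·) ∘ (fun a => l * u * a)) = α.map (ζ * ·) :=
      Multiset.map_congr rfl (fun a _ => by simp only [Function.comp_apply, hζ]; field_simp)
    have rhs : α.map (((l * u')⁻¹ * ·) ∘ (fun a => u' * (l * a))) = α := by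
      conv_rhs => rw [← Multiset.map_id α]
      exact Multiset.map_congr rfl (fun a _ => by simp only [Function.comp_apply, id]; field_simp)
    rw [lhs, rhs] at h
    exact h
  have hζp : ζ ^ p = 1 := by rw [hζ, mul_pow, inv_pow, hup, hu'p, inv_one, mul_one]
  have hζ1 : ζ ≠ 1 := fun h => hwsep (by
    rw [hζ, mul_inv_eq_one₀ hu'] at h
    exact h)
  have hα0 := Multiset.eq_zero_of_map_mul_eq hp hζp hζ1 (by rw [hα.card_eq]; exact hnp) hα.zero_not_mem hstab
  apply hn
  rw [← hα.card_eq, hα0, Multiset.card_zero]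

end Dichotomy

/-! ## Untwisting on the Galois side -/

section Untwist

variable {F : Type} [Field F] [NumberField F]

/-- **Untwisting.**  If a semisimple `ρ' : Γ_F → GL_n(ℚ̄_ℓ)` is unramified with arithmetic-Frobenius
polynomial `arithFrobPolyOfSatake ι q_w n (t_{π⊗μ,w})` at almost every `w`, then
`ρ = ρ' ⊗ r_{μ⁻¹}` (`r_{μ⁻¹}` the `ℓ`-adic avatar of `μ⁻¹`, with Frobenius value `ι⁻¹(μ(ϖ_w))`) is
semisimple and unramified with polynomial `arithFrobPolyOfSatake ι q_w n (t_{π,w})` at almost every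
`w` (`t_{π⊗μ,w} = μ(ϖ_w) t_{π,w}`; the roots `ι⁻¹((q^{(n-1)/2} a)⁻¹)` scale by `ι⁻¹(μ(ϖ_w))⁻¹`).
Arthur–Clozel 1989, Ch. 3 p. 172; Serre 1968, Ch. III §2.3. [folklore] -/
theorem untwist_galoisRep {n : ℕ} {hcpt : isCompact_glFiniteIntegralLevel n F}
    (π : AutomorphicRepData (AutomorphyDatum.gl n F hcpt)) (μ : HeckeCharacter F) (hμ : μ.IsFiniteOrder)
    {ℓ : ℕ} [Fact ℓ.Prime] (ι : PadicAlgCl ℓ ≃+* ℂ) (ρ' : FramedGaloisRep F (PadicAlgCl ℓ) n)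
    (hss : ρ'.toGaloisRep.IsSemisimple)
    (hρ' : ∀ᶠ w in Filter.cofinite, ∀ α : Multiset ℂ, (π.twist μ hμ).HasSatakeParamAt w α →
      ρ'.IsUnramifiedAt w ∧ ρ'.HasFrobCharpolyAt w (arithFrobPolyOfSatake ι w.residueCard n α)) :
    ∃ ρ : FramedGaloisRep F (PadicAlgCl ℓ) n, ρ.toGaloisRep.IsSemisimple ∧
      ∀ᶠ w in Filter.cofinite, ∀ α : Multiset ℂ, π.HasSatakeParamAt w α →
        ρ.IsUnramifiedAt w ∧ ρ.HasFrobCharpolyAt w (arithFrobPolyOfSatake ι w.residueCard n α) := by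
  have hμ' : μ⁻¹.IsFiniteOrder := hμ.inv
  obtain ⟨r, hrunr, hrfrob⟩ := HeckeCharacter.exists_lAdic_of_isFiniteOrder μ⁻¹ hμ' ι
  set χ : absoluteGaloisGroup F →ₜ* (PadicAlgCl ℓ)ˣ := FramedRep.det r with hχ
  refine ⟨FramedRep.twist ρ' χ, ?_, ?_⟩
  · -- semisimplicity is preserved by twisting
    show (FramedRep.toRepresentation (FramedRep.twist ρ' χ)).IsSemisimpleRepresentation
    rw [FramedRep.toRepresentation_twist]
    exact (Literature.RepresentationTheory.Semisimple.Representation.isSemisimpleRepresentation_twist_iff _ _).mpr hss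
  · filter_upwards [hρ', π.eventually_hasSatakeParamAt_twist hμ, eventually_isUnramifiedAt μ] with w hw1 hw2 hw3
    intro α hα
    set m := μ.valueAtUniformizer w with hm
    obtain ⟨hunr', hfrob'⟩ := hw1 _ (hw2 α hα)
    have hm0 : m ≠ 0 := Units.ne_zero _
    -- the avatar `r` at `w`: unramified with Frobenius value `z = ι⁻¹(m)`
    have hμ'w : μ⁻¹.IsUnramifiedAt w := HeckeCharacter.isUnramifiedAt_inv_iff.mpr hw3
    have hrw : r.IsUnramifiedAt w := (hrunr w).mpr hμ'w
    set z : PadicAlgCl ℓ := ι.symm m with hz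
    have hz0 : z ≠ 0 := by rw [hz, ι.symm.map_ne_zero_iff]; exact hm0
    have hrz : ∀ 𝔓 ∈ w.primesAbove, ∀ Φ : absoluteGaloisGroup F, IsArithFrobAt (𝓞 F) Φ 𝔓 →
        ((χ Φ : (PadicAlgCl ℓ)ˣ) : PadicAlgCl ℓ) = z := by
      have h := hrfrob w hμ'w
      rw [HeckeCharacter.valueAtUniformizer_inv, inv_inv, hasFrobCharpolyAt_iff_det'] at h
      exact h
    refine ⟨fun 𝔓 h𝔓 σ hσ => ?_, fun 𝔓 h𝔓 Φ hΦ => ?_⟩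
    · -- unramified
      have hχσ : χ σ = 1 := by
        rw [hχ, FramedRep.det_apply, hrw 𝔓 h𝔓 σ hσ, map_one]
      rw [FramedRep.twist_apply_of_eq_one ρ' χ hχσ]
      exact hunr' 𝔓 h𝔓 σ hσ
    · -- the Frobenius polynomial
      have hP := hfrob' 𝔓 h𝔓 Φ hΦ
      unfold FramedRep.charpoly at hP ⊢
      rw [FramedRep.coe_twist_apply, hrz 𝔓 h𝔓 Φ hΦ]
      set s : ℂ := ((Real.sqrt (w.residueCard : ℕ) : ℝ) : ℂ) ^ (n - 1) with hs
      have hP' : Matrix.charpoly ((ρ' Φ : GL (Fin n) (PadicAlgCl ℓ)) : Matrix (Fin n) (Fin n) (PadicAlgCl ℓ)) =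
          ((α.map fun a => z⁻¹ * ι.symm (s * a)⁻¹).map fun b => X - C b).prod := by
        rw [hP, arithFrobPolyOfSatake, Multiset.map_map, Multiset.map_map]
        congr 1
        refine Multiset.map_congr rfl fun a _ => ?_
        simp only [Function.comp_apply]
        rw [hz, ← map_inv₀, ← map_mul, hs]
        congr 2
        field_simp
      rw [Matrix.charpoly_smul_eq_prod _ hz0 hP', arithFrobPolyOfSatake, Multiset.map_map]
      congr 1
      refine Multiset.map_congr rfl fun a _ => ?_
      simp only [Function.comp_apply]
      rw [mul_inv_cancel_left₀ hz0]

end Untwist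

end Summit.Langlands.Langlands.Theorems.TwistNormalization

end
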